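import Summits.AtomisticToContinuum.HydrodynamicLimit.Theses.RelayRaceLocality

/-!
# Route RelayRaceLocality — the pure-logic `Assembly` item (stmt-AtomisticToContinuum-12505)

`Assembly` (rev 0–2 of the route) was

  `LightConeInLaw → NearConstantShortTimeHL → ConeLocalisation → RestartPrinciple →
   DiluteSelfConsistency → HydrodynamicLimit`,

i.e. the type of the route's deciding theorem `closes` without its (unused) `GibbsLightCone`
hypothesis, in the item's argument order.

Proof (pure logic, the body of `closes`): `ConeLocalisation` applied to `LightConeInLaw` and
`NearConstantShortTimeHL` gives the short-time guarded limit `S`; `RestartPrinciple` turns `S` into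
the packing-guarded conjunct with some `η₀ > 0`; `DiluteSelfConsistency` at `η := η₀` supplied the
packing guard `ρ_t σ³ < η₀` on `[0,T)` for `σ < σ₂` while the conjunct was the UNGUARDED Literature
statement; taking `σ₀ := min σ₁ σ₂` profile by profile and unfolding `HydrodynamicLimit` finished.

**Repair 2026-08-17 (fullbuild breakage "33:17: introN failed").** The closing theorem was stated as
`theorem relayRaceLocality_assembly_proof : RelayRaceLocality.Assembly` and so tracked the route decl
`Assembly`, which the route repair of 2026-08-16T23:16Z (rev 3, after the statement re-type p126922
made `_root_.HydrodynamicLimit` the PACKING-GUARDED conjunct — verbatim the consequent of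
`RestartPrinciple`) restated UNDER THE SAME NAME as the open three-antecedent item
stmt-AtomisticToContinuum-17333 `LightConeInLaw → NearConstantShortTimeHL → RestartPrinciple →
HydrodynamicLimit` (it packages the open support `ConeLocalisation`, stmt-12504; kernel-checked
`Assembly ↔ ConeLocalisation`, `Theorems/RelayRaceLocalityAssemblyConeEquivalence.lean`), dropping
`DiluteSelfConsistency` from the route (no guard is removed any more). The five-name `intro` stopped
elaborating and the live `Assembly` is not provable by bookkeeping; Theorems files are append-only (a
recorded declaration is neither restated nor removed), so the repair DEPRECATES: the chain the theorem
proved, minus the dropped and now idle guard-removal antecedent, is written out arrow for arrow as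
`relayRaceLocality_closes_chain : LightConeInLaw → NearConstantShortTimeHL → ConeLocalisation →
RestartPrinciple → HydrodynamicLimit := fun h₂ h₃ h₅ h₄ => h₄ (h₅ h₂ h₃)` (the body of the rev-3
`closes`), and the old name `relayRaceLocality_assembly_proof` (closing decl of record of stmt-12505 @
3df8881cdf11) is kept as a `@[deprecated]` alias of it. Neither proves the live item stmt-17333 (for
which see `RelayRaceLocalityAssemblyCone.assembly_of_coneLocalisation`), and neither serves a `_holds`
link.
-/

namespace Summit.AtomisticToContinuum.HydrodynamicLimit.Theorems

open Summit.AtomisticToContinuum.HydrodynamicLimit.Theses in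
/-- **The `closes` chain of route RelayRaceLocality, written out** (rev-0 `Assembly`,
stmt-AtomisticToContinuum-12505, minus the dropped guard-removal antecedent `DiluteSelfConsistency`):
`LightConeInLaw`, `NearConstantShortTimeHL`, the glue `ConeLocalisation` and `RestartPrinciple` imply
the sub-problem statement `_root_.HydrodynamicLimit` — `ConeLocalisation` produces the short-time
guarded limit from the first two and `RestartPrinciple` upgrades it to the packing-guarded conjunct,
which IS the Statement since the re-type p126922 (so no guard has to be removed). Pure logic, the
body of the route's deciding theorem `RelayRaceLocality.closes` without its idle `GibbsLightCone`
hypothesis. [folklore] -/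
theorem relayRaceLocality_closes_chain :
    RelayRaceLocality.LightConeInLaw → RelayRaceLocality.NearConstantShortTimeHL →
      RelayRaceLocality.ConeLocalisation → RelayRaceLocality.RestartPrinciple →
        _root_.HydrodynamicLimit :=
  fun h₂ h₃ h₅ h₄ => h₄ (h₅ h₂ h₃)

/-- **Deprecated record** of the closing theorem of stmt-AtomisticToContinuum-12505 (formerly
`theorem relayRaceLocality_assembly_proof : RelayRaceLocality.Assembly`, five antecedents incl.
`DiluteSelfConsistency`, @ 3df8881cdf11): its statement tracked the route decl `Assembly`, restated
under the same name at rev 3 (stmt-17333) as an OPEN three-antecedent item, and `DiluteSelfConsistency`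
left the route; the name is kept as an alias of the written-out chain it proved
(`relayRaceLocality_closes_chain`). [folklore] -/
@[deprecated relayRaceLocality_closes_chain (since := "2026-08-17")]
alias relayRaceLocality_assembly_proof := relayRaceLocality_closes_chain

end Summit.AtomisticToContinuum.HydrodynamicLimit.Theorems
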